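import Literature.Analysis.FluidPDE.CompressibleEulerCommutators
import HarnessLib

/-!
# Coefficient structure of the differentiated compressible Euler system

Analysis/FluidPDE support file (definitions with proved API; no named facts). The commutators
`FF w`, `GG ζ k w`, `HH ζ w` of the differentiated primitive Euler system with the monatomic law
`p = ρϑζ(ρ)` (`CompressibleEulerCommutators`; Majda 1984, Ch. 2 §2.1, proof of Thm 2.2) are sums
of differential monomials whose COEFFICIENTS are functions of the state `(ρ, ϑ)`. The shape
lemmas `mem_FF/GG/HH` only record that these coefficients are smooth on the quadrant, which gives
bounds on compact state sets by compactness — with constants depending on `ζ` in an uncontrolled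
way. For energy estimates UNIFORM in a family of laws `ζ` (e.g. the hard-sphere laws
`ζ_σ(r) = Z(rσ³)`, `σ → 0`) one needs the explicit structure, which this file records:

* `Arad ζ r = (ζ(r) + rζ'(r))/r`, the radial profile of `A = p_ρ/ρ = ϑ · Arad ζ (ρ)`
  (`Acoef_eq_mul_Arad`);
* the closed forms of the first coefficient derivatives `dR`/`dT` of `Acoef ζ`, `Zcoef ζ`,
  `Dcoef ζ` (`dR_Acoef`, `dT_Acoef`, `dR_Zcoef`, `dT_Zcoef`, `dR_Dcoef`, `dT_Dcoef`) and of the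
  normal form `c · θ^e · Φ(r)` (`dR_normalForm`, `dT_normalForm`);
* `IsCoeffShape S n g`: `g(r, θ) = c · θ^e · F^{(j)}(r)` with `|c| ≤ 1`, `e ≤ 1`, `j ≤ n` and a
  profile `F` from the generator set `S`; closed under `dR` (`n ↦ n + 1`) and `dT`, hence under
  the symbolic differentiation `DiffMonomial.dExp` (`isCoeffShape_coeff_of_mem_dExp`);
* **the structure theorems** `coeff_shape_FF` (coefficients of `FF w` are the constants `-1, 0`),
  `coeff_shape_GG` (generators `Arad ζ`, `ζ`, `1`), `coeff_shape_HH` (generators `ζ`, `1`), by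
  the induction on the word of `mem_GG`;
* **the bound corollaries** `coeff_bound_FF` (`|coeff| ≤ 1`), `coeff_bound_GG`,
  `coeff_bound_HH` (`|coeff(r, θ)| ≤ Θ · B` from `|θ| ≤ Θ`, `1 ≤ Θ`, `1 ≤ B` and
  `|F^{(j)}(r)| ≤ B` for the generators `F` and `j ≤ |w|`): the coefficient bound `G` of the
  per-term `L²` estimate `DiffMonomial.sqrt_integral_eval_sq_le` is thus controlled by `sup ϑ`
  and by bounds on `r`-derivatives of order `≤ |w|` of `Arad ζ` and `ζ` alone.

Design: all identities are equalities of functions valid for ALL real `(r, θ)`, with Mathlib's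
junk conventions `x/0 = 0` and `deriv f x = 0` at points of non-differentiability; no positivity
or differentiability hypotheses are needed because `deriv (fun x => c * f x) = c * deriv f`
holds unconditionally over a field (`deriv_const_mul_field`) and the `θ`-dependence is
polynomial. Deliberately NOT here: smoothness of the iterated derivatives on compact state sets
and the resulting uniform constants for a concrete family of laws (hard-sphere side), and the
energy inequality itself (`CompressibleEulerAprioriBounds`).

## References

* A. Majda, *Compressible Fluid Flow and Systems of Conservation Laws in Several Space
  Variables*, Springer 1984, Ch. 2 §2.1, Thm 2.1 (2.8a–c) and proof of Thm 2.2. [Majda1984]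
-/

noncomputable section

open Set Function
open scoped ContDiff

namespace Literature.Analysis.FluidPDE

namespace CompressibleEuler

open Literature.Analysis.FunctionSpaces Literature.Analysis.FunctionSpaces.Torus
open Literature.Analysis.FunctionSpaces.Torus.DiffMonomial

/-! ### The radial profile of `A` -/

/-- The radial profile `Arad ζ r = (ζ(r) + r ζ'(r)) / r = p_ρ / (ρ ϑ)` of the coefficient
`A(ρ, ϑ) = ϑ · Arad ζ (ρ)` of `∇ρ` in the velocity equation (junk value `x / 0 = 0` at `r = 0`,
as for `Acoef`). [cite: Majda1984, Ch. 2 §2.1 (2.8b)] -/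
def Arad (ζ : ℝ → ℝ) (r : ℝ) : ℝ := (ζ r + r * deriv ζ r) / r

variable {ζ : ℝ → ℝ}

/-- `A(r, θ) = θ · Arad ζ (r)` for all real `r, θ` (also at `r = 0`, both sides being `0`).
[cite: Majda1984, Ch. 2 §2.1 (2.8b)] -/
theorem Acoef_eq_mul_Arad (ζ : ℝ → ℝ) (r θ : ℝ) : Acoef ζ r θ = θ * Arad ζ r :=
  mul_div_assoc _ _ _

/-- `A = θ · Arad ζ` as functions. [cite: Majda1984, Ch. 2 §2.1 (2.8b)] -/
theorem Acoef_eq (ζ : ℝ → ℝ) : Acoef ζ = fun r θ => θ * Arad ζ r :=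
  funext fun r => funext fun θ => Acoef_eq_mul_Arad ζ r θ

/-- `Arad ζ` is smooth on `{r > 0}` when `ζ` is smooth. [folklore] -/
theorem contDiffOn_Arad (hζ : ContDiff ℝ ∞ ζ) : ContDiffOn ℝ ∞ (Arad ζ) (Ioi 0) := by
  have hζ' : ContDiff ℝ ∞ (deriv ζ) := (contDiff_infty_iff_deriv.1 hζ).2
  have h : Arad ζ = fun r => (ζ r + r * deriv ζ r) / r := rfl
  rw [h]
  exact (hζ.add (contDiff_id.mul hζ')).contDiffOn.div contDiffOn_id fun r hr => ne_of_gt hr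

/-! ### Closed forms of the coefficient derivatives -/

/-- `∂_r (c θ^e Φ(r)) = c θ^e Φ'(r)` for all `(r, θ)` (no differentiability needed). [folklore] -/
theorem dR_normalForm (c : ℝ) (e : ℕ) (Φ : ℝ → ℝ) :
    dR (fun r θ => c * θ ^ e * Φ r) = fun r θ => c * θ ^ e * deriv Φ r := by
  funext r θ
  simp only [dR]
  exact deriv_const_mul_field (c * θ ^ e)

/-- `∂_θ (c θ^e Φ(r)) = c e θ^{e-1} Φ(r)` for all `(r, θ)`. [folklore] -/
theorem dT_normalForm (c : ℝ) (e : ℕ) (Φ : ℝ → ℝ) :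
    dT (fun r θ => c * θ ^ e * Φ r) = fun r θ => c * e * θ ^ (e - 1) * Φ r := by
  funext r θ
  simp only [dT]
  have h : HasDerivAt (fun θ' : ℝ => c * θ' ^ e * Φ r) (c * ((e : ℝ) * θ ^ (e - 1)) * Φ r) θ :=
    ((hasDerivAt_pow e θ).const_mul c).mul_const (Φ r)
  rw [h.deriv]; ring

/-- `∂_r A = θ · (Arad ζ)'`. [cite: Majda1984, Ch. 2 §2.1 (2.8b)] -/
theorem dR_Acoef (ζ : ℝ → ℝ) : dR (Acoef ζ) = fun r θ => θ * deriv (Arad ζ) r := by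
  funext r θ
  simp only [dR, Acoef_eq_mul_Arad]
  exact deriv_const_mul_field θ

/-- `∂_θ A = Arad ζ`. [cite: Majda1984, Ch. 2 §2.1 (2.8b)] -/
theorem dT_Acoef (ζ : ℝ → ℝ) : dT (Acoef ζ) = fun r _ => Arad ζ r := by
  funext r θ
  simp only [dT, Acoef_eq_mul_Arad]
  rw [((hasDerivAt_id' θ).mul_const (Arad ζ r)).deriv, one_mul]

/-- `∂_r ζ = ζ'`. [cite: Majda1984, Ch. 2 §2.1 (2.8b)] -/
theorem dR_Zcoef (ζ : ℝ → ℝ) : dR (Zcoef ζ) = fun r _ => deriv ζ r := by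
  funext r θ; rfl

/-- `∂_θ ζ = 0`. [cite: Majda1984, Ch. 2 §2.1 (2.8b)] -/
theorem dT_Zcoef (ζ : ℝ → ℝ) : dT (Zcoef ζ) = fun _ _ => 0 := by
  funext r θ; simp [dT, Zcoef]

/-- `∂_r D = (2/3) θ ζ'`. [cite: Majda1984, Ch. 2 §2.1 (2.8c)] -/
theorem dR_Dcoef (ζ : ℝ → ℝ) : dR (Dcoef ζ) = fun r θ => 2 / 3 * θ * deriv ζ r := by
  funext r θ
  simp only [dR, Dcoef]
  rw [deriv_const_mul_field, deriv_const_mul_field, mul_assoc]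

/-- `∂_θ D = (2/3) ζ`. [cite: Majda1984, Ch. 2 §2.1 (2.8c)] -/
theorem dT_Dcoef (ζ : ℝ → ℝ) : dT (Dcoef ζ) = fun r _ => 2 / 3 * ζ r := by
  funext r θ
  simp only [dT, Dcoef]
  rw [deriv_const_mul_field, ((hasDerivAt_id' θ).mul_const (ζ r)).deriv, one_mul]

/-- Iterated derivatives of a constant vanish from the first one on. [folklore] -/
theorem iterate_deriv_const_succ (j : ℕ) (c : ℝ) : deriv^[j + 1] (fun _ : ℝ => c) = fun _ => 0 := by
  induction j with
  | zero => simp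
  | succ j ih => rw [Function.iterate_succ_apply', ih]; exact deriv_const' 0

/-- `|∂^j 1| ≤ 1` for the constant profile. [folklore] -/
theorem abs_iterate_deriv_one_le (j : ℕ) (r : ℝ) : |deriv^[j] (fun _ : ℝ => (1 : ℝ)) r| ≤ 1 := by
  cases j with
  | zero => simp
  | succ j => rw [iterate_deriv_const_succ]; simp

/-! ### The coefficient shape predicate -/

/-- **Coefficient shape.** `IsCoeffShape S n g`: the coefficient `g(r, θ)` is
`c · θ^e · F^{(j)}(r)` for a constant `|c| ≤ 1`, an exponent `e ≤ 1`, a derivative order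
`j ≤ n` and a radial profile `F` from the generator set `S`. [folklore] -/
def IsCoeffShape (S : Set (ℝ → ℝ)) (n : ℕ) (g : ℝ → ℝ → ℝ) : Prop :=
  ∃ (c : ℝ) (e j : ℕ) (F : ℝ → ℝ), |c| ≤ 1 ∧ e ≤ 1 ∧ j ≤ n ∧ F ∈ S ∧
    g = fun r θ => c * θ ^ e * deriv^[j] F r

/-- Monotonicity of the shape predicate in the derivative budget. [folklore] -/
theorem IsCoeffShape.mono {S : Set (ℝ → ℝ)} {n m : ℕ} {g : ℝ → ℝ → ℝ} (h : IsCoeffShape S n g)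
    (hnm : n ≤ m) : IsCoeffShape S m g := by
  obtain ⟨c, e, j, F, hc, he, hj, hF, rfl⟩ := h
  exact ⟨c, e, j, F, hc, he, hj.trans hnm, hF, rfl⟩

/-- Monotonicity of the shape predicate in the generator set. [folklore] -/
theorem IsCoeffShape.mono_set {S S' : Set (ℝ → ℝ)} {n : ℕ} {g : ℝ → ℝ → ℝ} (h : IsCoeffShape S n g)
    (hS : S ⊆ S') : IsCoeffShape S' n g := by
  obtain ⟨c, e, j, F, hc, he, hj, hF, rfl⟩ := h
  exact ⟨c, e, j, F, hc, he, hj, hS hF, rfl⟩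

/-- Constants of modulus `≤ 1` have the shape, with the constant profile `1`. [folklore] -/
theorem isCoeffShape_const {S : Set (ℝ → ℝ)} (h1 : (fun _ : ℝ => (1 : ℝ)) ∈ S) {c : ℝ} (hc : |c| ≤ 1)
    (n : ℕ) : IsCoeffShape S n fun _ _ => c :=
  ⟨c, 0, 0, fun _ => 1, hc, zero_le_one, Nat.zero_le _, h1, by funext r θ; simp⟩

/-- **Closure under `∂_r`** (one more derivative on the profile). [folklore] -/
theorem IsCoeffShape.dR {S : Set (ℝ → ℝ)} {n : ℕ} {g : ℝ → ℝ → ℝ} (h : IsCoeffShape S n g) :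
    IsCoeffShape S (n + 1) (DiffMonomial.dR g) := by
  obtain ⟨c, e, j, F, hc, he, hj, hF, rfl⟩ := h
  refine ⟨c, e, j + 1, F, hc, he, by omega, hF, ?_⟩
  rw [dR_normalForm]
  funext r θ
  rw [Function.iterate_succ_apply']

/-- **Closure under `∂_θ`** (the exponent drops, the constant picks up `e ≤ 1`). [folklore] -/
theorem IsCoeffShape.dT {S : Set (ℝ → ℝ)} {n : ℕ} {g : ℝ → ℝ → ℝ} (h : IsCoeffShape S n g) :
    IsCoeffShape S n (DiffMonomial.dT g) := by
  obtain ⟨c, e, j, F, hc, he, hj, hF, rfl⟩ := h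
  refine ⟨c * e, e - 1, j, F, ?_, by omega, hj, hF, dT_normalForm c e _⟩
  rw [abs_mul, Nat.abs_cast]
  interval_cases e
  · simp
  · simpa using hc

/-- **Closure under the symbolic differentiation `dExp`**: the members of `dExp a b i T` have
coefficient `∂_r g`, `∂_θ g` or `g`. [folklore] -/
theorem isCoeffShape_coeff_of_mem_dExp {d κ : Type*} {S : Set (ℝ → ℝ)} {n : ℕ} {a b : κ} {i : d}
    {T T' : DiffMonomial d κ} (hT : IsCoeffShape S n T.coeff) (h : T' ∈ dExp a b i T) :
    IsCoeffShape S (n + 1) T'.coeff := by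
  simp only [dExp, List.mem_cons, List.mem_map] at h
  rcases h with rfl | rfl | ⟨gs, -, rfl⟩
  · exact hT.dR
  · exact hT.dT.mono (Nat.le_succ n)
  · exact hT.mono (Nat.le_succ n)

/-- **The bound carried by the shape**: `|g(r, θ)| ≤ Θ · B` whenever `|θ| ≤ Θ`, `1 ≤ Θ`, and
`|F^{(j)}(r)| ≤ B` for all generators `F ∈ S` and `j ≤ n`. [folklore] -/
theorem IsCoeffShape.abs_le {S : Set (ℝ → ℝ)} {n : ℕ} {g : ℝ → ℝ → ℝ} (h : IsCoeffShape S n g)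
    {r θ Θ B : ℝ} (hΘ : 1 ≤ Θ) (hθ : |θ| ≤ Θ) (hB : ∀ F ∈ S, ∀ j ≤ n, |deriv^[j] F r| ≤ B) :
    |g r θ| ≤ Θ * B := by
  obtain ⟨c, e, j, F, hc, he, hj, hF, rfl⟩ := h
  have hD := hB F hF j hj
  have hΘ0 : (0 : ℝ) ≤ Θ := zero_le_one.trans hΘ
  have hΘe : |θ| ^ e ≤ Θ := by
    interval_cases e
    · simpa using hΘ
    · simpa using hθ
  show |c * θ ^ e * deriv^[j] F r| ≤ Θ * B
  rw [abs_mul, abs_mul, abs_pow]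
  calc |c| * |θ| ^ e * |deriv^[j] F r| = |c| * (|θ| ^ e * |deriv^[j] F r|) := mul_assoc _ _ _
    _ ≤ 1 * (|θ| ^ e * |deriv^[j] F r|) := mul_le_mul_of_nonneg_right hc (by positivity)
    _ = |θ| ^ e * |deriv^[j] F r| := one_mul _
    _ ≤ Θ * B := mul_le_mul hΘe hD (abs_nonneg _) hΘ0

/-! ### Structure of the coefficients of `FF`, `GG`, `HH` -/

/-- **Coefficients of `FF w` are the constants `-1` or `0`.** [cite: Majda1984, Ch. 2 §2.1 Thm 2.2] -/
theorem coeff_shape_FF : ∀ (w : List (Fin 3)) {T : DiffMonomial (Fin 3) PIdx}, T ∈ FF w →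
    ∃ c : ℝ, |c| ≤ 1 ∧ T.coeff = fun _ _ => c
  | [], T, h => by simp [FF] at h
  | j :: w, T, h => by
    simp only [FF, List.mem_append, List.mem_ofFn] at h
    rcases h with (h | ⟨i, rfl⟩) | ⟨k, rfl⟩
    · obtain ⟨T₀, hT₀, hT⟩ := List.mem_flatMap.1 h
      obtain ⟨c, hc, hc'⟩ := coeff_shape_FF w hT₀
      simp only [dExp, List.mem_cons, List.mem_map] at hT
      rcases hT with rfl | rfl | ⟨gs, -, rfl⟩
      · exact ⟨0, by simp, by funext r θ; simp [hc', DiffMonomial.dR]⟩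
      · exact ⟨0, by simp, by funext r θ; simp [hc', DiffMonomial.dT]⟩
      · exact ⟨c, hc, hc'⟩
    · exact ⟨-1, by simp, rfl⟩
    · exact ⟨-1, by simp, rfl⟩

/-- The generator set of the velocity-equation coefficients: `Arad ζ`, `ζ` and the constant `1`.
[cite: Majda1984, Ch. 2 §2.1 (2.8b)] -/
def genGG (ζ : ℝ → ℝ) : Set (ℝ → ℝ) := {Arad ζ, ζ, fun _ => 1}

/-- The generator set of the temperature-equation coefficients: `ζ` and the constant `1`.
[cite: Majda1984, Ch. 2 §2.1 (2.8c)] -/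
def genHH (ζ : ℝ → ℝ) : Set (ℝ → ℝ) := {ζ, fun _ => 1}

/-- `genHH ζ ⊆ genGG ζ`. [folklore] -/
theorem genHH_subset_genGG (ζ : ℝ → ℝ) : genHH ζ ⊆ genGG ζ := by
  intro F hF
  simp only [genHH, genGG, Set.mem_insert_iff, Set.mem_singleton_iff] at hF ⊢
  exact Or.inr hF

/-- **Coefficients of `GG ζ k w`** are `c · θ^e · F^{(j)}(r)` with `|c| ≤ 1`, `e ≤ 1`, `j ≤ |w|`,
`F ∈ {Arad ζ, ζ, 1}`. [cite: Majda1984, Ch. 2 §2.1 Thm 2.2] -/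
theorem coeff_shape_GG (ζ : ℝ → ℝ) (k : Fin 3) : ∀ (w : List (Fin 3)) {T : DiffMonomial (Fin 3) PIdx},
    T ∈ GG ζ k w → IsCoeffShape (genGG ζ) w.length T.coeff
  | [], T, h => by simp [GG] at h
  | j :: w, T, h => by
    have hA : Arad ζ ∈ genGG ζ := by simp [genGG]
    have hZ : ζ ∈ genGG ζ := by simp [genGG]
    have h1 : (fun _ : ℝ => (1 : ℝ)) ∈ genGG ζ := by simp [genGG]
    simp only [GG, List.mem_append, List.mem_ofFn, List.mem_cons, List.mem_nil_iff, or_false] at h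
    simp only [List.length_cons]
    rcases h with (h | ⟨i, rfl⟩) | rfl | rfl | rfl | rfl
    · obtain ⟨T₀, hT₀, hT⟩ := List.mem_flatMap.1 h
      exact isCoeffShape_coeff_of_mem_dExp (coeff_shape_GG ζ k w hT₀) hT
    · exact isCoeffShape_const (c := -1) h1 (by simp) _
    · exact ⟨-1, 1, 1, Arad ζ, by simp, le_rfl, by omega, hA, by funext r θ; simp [dR_Acoef]⟩
    · exact ⟨-1, 0, 0, Arad ζ, by simp, zero_le_one, Nat.zero_le _, hA, by funext r θ; simp [dT_Acoef]⟩
    · exact ⟨-1, 0, 1, ζ, by simp, zero_le_one, by omega, hZ, by funext r θ; simp [dR_Zcoef]⟩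
    · exact ⟨0, 0, 0, ζ, by simp, zero_le_one, Nat.zero_le _, hZ, by funext r θ; simp [dT_Zcoef]⟩

/-- **Coefficients of `HH ζ w`** are `c · θ^e · F^{(j)}(r)` with `|c| ≤ 1`, `e ≤ 1`, `j ≤ |w|`,
`F ∈ {ζ, 1}`. [cite: Majda1984, Ch. 2 §2.1 Thm 2.2] -/
theorem coeff_shape_HH (ζ : ℝ → ℝ) : ∀ (w : List (Fin 3)) {T : DiffMonomial (Fin 3) PIdx},
    T ∈ HH ζ w → IsCoeffShape (genHH ζ) w.length T.coeff
  | [], T, h => by simp [HH] at h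
  | j :: w, T, h => by
    have hZ : ζ ∈ genHH ζ := by simp [genHH]
    have h1 : (fun _ : ℝ => (1 : ℝ)) ∈ genHH ζ := by simp [genHH]
    have h23 : |(-(2 / 3) : ℝ)| ≤ 1 := abs_le.2 ⟨by norm_num, by norm_num⟩
    simp only [HH, List.mem_append, List.mem_ofFn] at h
    simp only [List.length_cons]
    rcases h with ((h | ⟨i, rfl⟩) | ⟨k, rfl⟩) | ⟨k, rfl⟩
    · obtain ⟨T₀, hT₀, hT⟩ := List.mem_flatMap.1 h
      exact isCoeffShape_coeff_of_mem_dExp (coeff_shape_HH ζ w hT₀) hT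
    · exact isCoeffShape_const (c := -1) h1 (by simp) _
    · exact ⟨-(2 / 3), 1, 1, ζ, h23, le_rfl, by omega, hZ, by funext r θ; simp [dR_Dcoef]⟩
    · exact ⟨-(2 / 3), 0, 0, ζ, h23, zero_le_one, Nat.zero_le _, hZ, by funext r θ; simp [dT_Dcoef]⟩

/-! ### Bound form -/

/-- **`|coeff| ≤ 1` on `FF w`.** [cite: Majda1984, Ch. 2 §2.1 Thm 2.2] -/
theorem coeff_bound_FF {w : List (Fin 3)} {T : DiffMonomial (Fin 3) PIdx} (hT : T ∈ FF w) (r θ : ℝ) :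
    |T.coeff r θ| ≤ 1 := by
  obtain ⟨c, hc, hc'⟩ := coeff_shape_FF w hT
  rw [hc']; exact hc

/-- **Coefficient bound on `GG ζ k w`**: `|coeff(r, θ)| ≤ Θ · B` from `1 ≤ Θ`, `1 ≤ B`, `|θ| ≤ Θ`
and `|(Arad ζ)^{(j)}(r)|, |ζ^{(j)}(r)| ≤ B` for `j ≤ |w|`. [cite: Majda1984, Ch. 2 §2.1 Thm 2.2] -/
theorem coeff_bound_GG {k : Fin 3} {w : List (Fin 3)} {T : DiffMonomial (Fin 3) PIdx}
    (hT : T ∈ GG ζ k w) {r θ Θ B : ℝ} (hΘ : 1 ≤ Θ) (hB : 1 ≤ B) (hθ : |θ| ≤ Θ)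
    (hA : ∀ j ≤ w.length, |deriv^[j] (Arad ζ) r| ≤ B) (hZ : ∀ j ≤ w.length, |deriv^[j] ζ r| ≤ B) :
    |T.coeff r θ| ≤ Θ * B := by
  refine (coeff_shape_GG ζ k w hT).abs_le hΘ hθ ?_
  intro F hF j hj
  simp only [genGG, Set.mem_insert_iff, Set.mem_singleton_iff] at hF
  rcases hF with rfl | rfl | rfl
  · exact hA j hj
  · exact hZ j hj
  · exact (abs_iterate_deriv_one_le j r).trans hB

/-- **Coefficient bound on `HH ζ w`**: `|coeff(r, θ)| ≤ Θ · B` from `1 ≤ Θ`, `1 ≤ B`, `|θ| ≤ Θ` and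
`|ζ^{(j)}(r)| ≤ B` for `j ≤ |w|`. [cite: Majda1984, Ch. 2 §2.1 Thm 2.2] -/
theorem coeff_bound_HH {w : List (Fin 3)} {T : DiffMonomial (Fin 3) PIdx}
    (hT : T ∈ HH ζ w) {r θ Θ B : ℝ} (hΘ : 1 ≤ Θ) (hB : 1 ≤ B) (hθ : |θ| ≤ Θ)
    (hZ : ∀ j ≤ w.length, |deriv^[j] ζ r| ≤ B) :
    |T.coeff r θ| ≤ Θ * B := by
  refine (coeff_shape_HH ζ w hT).abs_le hΘ hθ ?_
  intro F hF j hj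
  simp only [genHH, Set.mem_insert_iff, Set.mem_singleton_iff] at hF
  rcases hF with rfl | rfl
  · exact hZ j hj
  · exact (abs_iterate_deriv_one_le j r).trans hB

/-- **All three families at once, on a state set `K`**: if `|θ| ≤ Θ` on `K` and the derivatives of
order `≤ |w|` of `Arad ζ` and `ζ` are bounded by `B` on (the first projection of) `K`, then every
coefficient of `FF w`, `GG ζ k w`, `HH ζ w` is bounded by `Θ · B` on `K`.
[cite: Majda1984, Ch. 2 §2.1 Thm 2.2] -/
theorem coeff_bound_of_mem {K : Set (ℝ × ℝ)} {Θ B : ℝ} (hΘ : 1 ≤ Θ) (hB : 1 ≤ B)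
    (hθ : ∀ z ∈ K, |z.2| ≤ Θ) (w : List (Fin 3))
    (hD : ∀ z ∈ K, ∀ j ≤ w.length, |deriv^[j] (Arad ζ) z.1| ≤ B ∧ |deriv^[j] ζ z.1| ≤ B) :
    ∀ z ∈ K, (∀ T ∈ FF w, |T.coeff z.1 z.2| ≤ Θ * B) ∧
      (∀ k, ∀ T ∈ GG ζ k w, |T.coeff z.1 z.2| ≤ Θ * B) ∧ (∀ T ∈ HH ζ w, |T.coeff z.1 z.2| ≤ Θ * B) := by
  intro z hz
  have h1 : (1 : ℝ) ≤ Θ * B := by nlinarith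
  exact ⟨fun T hT => (coeff_bound_FF hT _ _).trans h1,
    fun k T hT => coeff_bound_GG hT hΘ hB (hθ z hz) (fun j hj => (hD z hz j hj).1) fun j hj => (hD z hz j hj).2,
    fun T hT => coeff_bound_HH hT hΘ hB (hθ z hz) fun j hj => (hD z hz j hj).2⟩

end CompressibleEuler

end Literature.Analysis.FluidPDE
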